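import Literature.NumberTheory.Sieve.ChenTwinUpperBCard
import Literature.NumberTheory.Sieve.ChenTwinUpperBRemainder
import HarnessLib

/-!
# Chen's theorem, twin form: the sieve estimate (C) PROVED (`twin_sieveUpperB_holds`)

Topic `Literature/NumberTheory/Sieve`, family `parity`; the "Proofs" companion of
`Literature.NumberTheory.Sieve.ChenTwin` for the named fact
`Literature.NumberTheory.Sieve.Chen.twin_sieveUpperB` — DAG node (C) of the decomposition of
`Literature.NumberTheory.Sieve.chen_twin`, the twin-form analogue (Chen, Sci. Sinica 16 (1973), p. 176:
"by the same method") of Nathanson, *Additive Number Theory: The Classical Bases* (GTM 164),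
Theorem 10.6: for every `ε > 0` and all large `x`,

  `S(B(x), y) ≤ (c e^γ/2 + ε) · (x/log x) · V(x^{1/8})`,  `B(x) = {p₁p₂p₃ − 2}`, `y = (x+3)^{1/3}`.

The three steps of the printed proof are theorems of the tree:
1. the sieve step `Literature.NumberTheory.Sieve.Chen.twin_sieveUpperB_of` (`ChenTwinUpperB.lean`:
   Iwaniec's linear sieve, `F₁(s) = 2e^γ/s`, Mertens);
2. the remainder bound `Literature.NumberTheory.Sieve.Chen.chenRemainderExt_bound`
   (`ChenTwinUpperBRemainder.lean`: Nathanson (10.15) from Thm 10.7, `Bilinear.primes_explicit`, with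
   the Siegel–Walfisz theorem and the large sieve);
3. the cardinality bound `Literature.NumberTheory.Sieve.Chen.chenTriplesExt_card_bound`
   (`ChenTwinUpperBCard.lean`: the prime number theorem and Mertens' theorems; `c = switchingConstant`).

This file assembles them: `twin_sieveUpperB_holds`. Everything is PROVED; no definitions, no
named facts.

## References

* M. B. Nathanson, *Additive Number Theory: The Classical Bases*, GTM 164 (1996), Thm 10.6 and its
  proof, pp. 175–182 of the held copy. [Nathanson1996]
* Chen Jing-run, Sci. Sinica 16 (1973), 157–176, p. 176. [ChenSciSinica1973]
-/

namespace Literature.NumberTheory.Sieve.Chen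

/-- **Estimate (C) of the twin form of Chen's theorem, PROVED**
(`Literature.NumberTheory.Sieve.Chen.twin_sieveUpperB`, the analogue of Nathanson's Theorem 10.6 for
`B(x) = {p₁p₂p₃ − 2}`): for every `ε > 0` and all large `x`,
`S(B(x), (x+3)^{1/3}) ≤ (c e^γ/2 + ε) (x/log x) V(x^{1/8})`. Discharge of the named fact from the
three proved steps of the printed proof. [cite: Nathanson1996, Thm 10.6 (for the sequence {p+2}: ChenSciSinica1973, p. 176)] -/
theorem twin_sieveUpperB_holds : twin_sieveUpperB :=
  twin_sieveUpperB_of chenTriplesExt_card_bound chenRemainderExt_bound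

end Literature.NumberTheory.Sieve.Chen
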